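import Literature.AlgebraicGeometry.Resolution.NeronPopescuResolveSpecialProof
import Mathlib.RingTheory.RegularLocalRing.Defs
import Mathlib.RingTheory.Valuation.ValuationSubring
import HarnessLib

/-!
# The crux `IndSmooth.ValuativeSmoothing` at NOETHERIAN valuation rings, unconditionally
# (crux stmt-ResolutionOfSingularities-16087, line `birth`, support)

The crux `Summit.ResolutionOfSingularities.ResolutionOfSingularities.Theses.IndSmooth.ValuativeSmoothing`
asks, for a perfect field `k`, a field `K ⊇ k` and a valuation ring `O ⊇ k` of `K`, that every
finitely generated `k`-subalgebra `R ⊆ O` factor `R → T → O` through a SMOOTH `k`-algebra `T`.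
This file proves it — together with the one-`p`-th-root kernel of the reduction
`IndSmoothValuativeSmoothingReduction.lean` — UNCONDITIONALLY whenever `O` is NOETHERIAN (a
discrete valuation ring, or `K` itself), for every field `K ⊇ k` (no finite generation and no
characteristic hypothesis). So the open content of the crux is entirely non-Noetherian.

Mechanism: general Néron desingularization over a PERFECT field is available in the tree without
the missing Lemma 07FJ of the Stacks Project, because Lemma 07FE (the separable residue field
case, discharged as `Literature.AlgebraicGeometry.Resolution.Stacks07FE_resolveSpecial_holds`)
covers EVERY minimal prime when `k` is perfect (every field extension of a perfect field is
separable in the sense of Tag 030O, `isSeparableFieldExtension_of_perfectField`). Feeding it to the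
Noetherian induction of Tag 07GC (`hasSmoothFactorizations_of_canResolveAtMinimalPrimes`) gives

* `canResolveAtMinimalPrimes_of_perfectField`, `hasSmoothFactorizations_of_perfectField`: for `k`
  perfect and `Λ` a regular (Noetherian) `k`-algebra, every `A → Λ` with `A` of finite type over
  `k` factors through a smooth `k`-algebra (PT for `k → Λ`, the field case of Stacks 07GC, in
  every characteristic) — the reusable content of this file;
* `isRegularRing_valuationSubring_of_isNoetherianRing`: a Noetherian valuation ring is a regular
  ring (valuation ⇒ Bézout, Noetherian Bézout ⇒ principal, PID ⇒ Dedekind ⇒ regular: Mathlib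
  instances);
* `smoothFactor_of_isNoetherianRing`: the crux at Noetherian `O`, and `smoothFactor_top`, the
  case `O = K`;
* `pthRootSmoothing_of_isNoetherianRing`: the one-root kernel at Noetherian `O` (apply the
  previous theorem to the finitely generated subalgebra `φ(T)[y] ⊆ O`, as in
  `pthRootSmoothing_of_valuativeSmoothing`), and `pthRootSmoothing_top`, the case `O = K`.
-/

-- single-problem summit: the doubled namespace component is forced
set_option linter.dupNamespace false

namespace Summit.ResolutionOfSingularities.ResolutionOfSingularities.Theorems.ValuativeSmoothing

open Literature.AlgebraicGeometry.Resolution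

universe u

/-- **General Néron desingularization over a perfect field, local form (Stacks 07GC with Lemma
07FE only).** For a perfect field `k` and a regular Noetherian `k`-algebra `Λ`, every
`k → A → Λ ⊃ 𝔮` with `A` of finite presentation over `k` and `𝔮` minimal over `𝔥_A` can be
resolved: hypotheses (4) (`Λ_𝔮` regular) and (5) (`κ(𝔮)/k` separable — automatic over a perfect
field, Stacks 030W) of Lemma 07FE hold at every prime, so Lemma 07FJ is not needed.
[cite: StacksProject, Tag 07GC] -/
theorem canResolveAtMinimalPrimes_of_perfectField (k Λ : Type u) [Field k] [PerfectField k]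
    [CommRing Λ] [Algebra k Λ] [IsRegularRing Λ] : CanResolveAtMinimalPrimes k Λ :=
  fun A _ _ hA φ q _ hqmin =>
    Stacks07FE_resolveSpecial_holds k A Λ hA inferInstance φ q hqmin
      (IsRegularRing.isRegularLocalRing_localization q)
      (isSeparableFieldExtension_of_perfectField k _)

/-- **General Néron desingularization over a perfect field (the field case of Stacks 07GC, in
every characteristic).** For a perfect field `k` and a regular Noetherian `k`-algebra `Λ`, PT holds
for `k → Λ`: every `k`-algebra map `A → Λ` with `A` of finite type over `k` factors through a
smooth `k`-algebra. Unconditional: the Noetherian induction of 07GC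
(`hasSmoothFactorizations_of_canResolveAtMinimalPrimes`) fed with Lemma 07FE at every minimal
prime (`canResolveAtMinimalPrimes_of_perfectField`). [cite: StacksProject, Tag 07GC] -/
theorem hasSmoothFactorizations_of_perfectField (k Λ : Type u) [Field k] [PerfectField k]
    [CommRing Λ] [Algebra k Λ] [IsRegularRing Λ] : HasSmoothFactorizations k Λ :=
  hasSmoothFactorizations_of_canResolveAtMinimalPrimes
    (canResolveAtMinimalPrimes_of_perfectField k Λ)

/-- A Noetherian valuation ring (of a field `K`) is a regular ring: a valuation ring is Bézout, a
Noetherian Bézout ring is a principal ideal ring, a principal ideal domain is a Dedekind domain,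
and the local rings of a Dedekind domain are discrete valuation rings or fields, hence regular
(all four steps are Mathlib instances). [folklore] -/
theorem isRegularRing_valuationSubring_of_isNoetherianRing {K : Type u} [Field K]
    (O : ValuationSubring K) (hN : IsNoetherianRing O) : IsRegularRing O := by
  haveI := hN
  haveI : IsPrincipalIdealRing O := IsPrincipalIdealRing.of_isNoetherianRing_of_isBezout
  infer_instance

/-- **The crux at Noetherian valuation rings.** For a perfect field `k`, a field `K ⊇ k` and a
NOETHERIAN valuation ring `O ⊇ k` of `K`, every finitely generated `k`-subalgebra `R ⊆ O` factors
`R → T → O` through a smooth `k`-algebra `T` (`ψ : R → T`, `χ : T → K` with image in `O`,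
`χ ∘ ψ` the inclusion): general Néron desingularization over the perfect field `k` for the regular
Noetherian `k`-algebra `O` (`hasSmoothFactorizations_of_perfectField`), applied to the inclusion
`R → O`. [folklore] -/
theorem smoothFactor_of_isNoetherianRing (k K : Type) [Field k] [PerfectField k] [Field K]
    [Algebra k K] (O : ValuationSubring K) (hO : ∀ c : k, algebraMap k K c ∈ O)
    (hN : IsNoetherianRing O) (R : Subalgebra k K) (hR : R.FG) (hRO : R.toSubring ≤ O.toSubring) :
    ∃ (T : Type) (_ : CommRing T) (_ : Algebra k T), Algebra.Smooth k T ∧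
      ∃ (ψ : R →ₐ[k] T) (χ : T →ₐ[k] K), (∀ t : T, χ t ∈ O) ∧ ∀ r : R, χ (ψ r) = (r : K) := by
  letI : Algebra k O := ((algebraMap k K).codRestrict O.toSubring hO).toAlgebra
  haveI : IsScalarTower k O K := IsScalarTower.of_algebraMap_eq fun _ => rfl
  haveI : IsRegularRing O := isRegularRing_valuationSubring_of_isNoetherianRing O hN
  haveI : Algebra.FiniteType k R := R.fg_iff_finiteType.mp hR
  -- the inclusion `R ⊆ O` as a `k`-algebra map
  let φ : R →ₐ[k] O :=
    { toFun := fun r => ⟨(r : K), hRO r.2⟩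
      map_one' := rfl
      map_mul' := fun _ _ => rfl
      map_zero' := rfl
      map_add' := fun _ _ => rfl
      commutes' := fun _ => rfl }
  obtain ⟨C, _, _, hC, v, w, hwv⟩ :=
    hasSmoothFactorizations_of_perfectField k O R inferInstance φ
  refine ⟨C, inferInstance, inferInstance, hC, v, (IsScalarTower.toAlgHom k O K).comp w,
    fun t => (w t).2, fun r => ?_⟩
  exact congrArg (fun x : O => (x : K)) (AlgHom.congr_fun hwv r)

/-- The case `O = K` (the trivial valuation ring, a field, hence Noetherian): over a perfect field
`k`, every finitely generated `k`-subalgebra `R` of any field `K ⊇ k` factors `R → T → K` through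
a smooth `k`-algebra `T`, the composite being the inclusion. [folklore] -/
theorem smoothFactor_top (k K : Type) [Field k] [PerfectField k] [Field K] [Algebra k K]
    (R : Subalgebra k K) (hR : R.FG) :
    ∃ (T : Type) (_ : CommRing T) (_ : Algebra k T), Algebra.Smooth k T ∧
      ∃ (ψ : R →ₐ[k] T) (χ : T →ₐ[k] K), ∀ r : R, χ (ψ r) = (r : K) := by
  obtain ⟨T, _, _, hT, ψ, χ, -, h⟩ := smoothFactor_of_isNoetherianRing k K ⊤
    (fun c => ValuationSubring.mem_top _) inferInstance R hR (fun x _ => Subring.mem_top x)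
  exact ⟨T, inferInstance, inferInstance, hT, ψ, χ, h⟩

/-- **The one-root kernel at Noetherian valuation rings.** For a perfect field `k`, a field
`K ⊇ k`, a NOETHERIAN valuation ring `O ⊇ k` of `K`, a smooth `k`-algebra `T` with a `k`-map
`φ : T → K` into `O`, `g ∈ T` and `y ∈ O` with `y ^ p = φ g`, the datum factors through a smooth
`k`-algebra `T'` (`ψ : T → T'`, `u ∈ T'` with `u ^ p = ψ g`, `χ : T' → K` into `O`, `χ ∘ ψ = φ`,
`χ u = y`): apply `smoothFactor_of_isNoetherianRing` to the finitely generated subalgebra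
`φ(T)[y] ⊆ O` and precompose with `T → φ(T)[y]`. [folklore] -/
theorem pthRootSmoothing_of_isNoetherianRing (p : ℕ) (k K : Type) [Field k] [PerfectField k]
    [Field K] [Algebra k K] (O : ValuationSubring K) (hO : ∀ c : k, algebraMap k K c ∈ O)
    (hN : IsNoetherianRing O) (T : Type) [CommRing T] [Algebra k T] (hTs : Algebra.Smooth k T)
    (φ : T →ₐ[k] K) (hφ : ∀ t : T, φ t ∈ O) (g : T) (y : K) (hy : y ∈ O) (hyg : y ^ p = φ g) :
    ∃ (T' : Type) (_ : CommRing T') (_ : Algebra k T'), Algebra.Smooth k T' ∧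
      ∃ (ψ : T →ₐ[k] T') (u : T') (χ : T' →ₐ[k] K),
        (∀ t : T', χ t ∈ O) ∧ (∀ t : T, χ (ψ t) = φ t) ∧ u ^ p = ψ g ∧ χ u = y := by
  classical
  haveI : Algebra.FinitePresentation k T := hTs.finitePresentation
  haveI : Algebra.FiniteType k T := inferInstance
  -- `B = φ(T)[y]`, finitely generated, inside `O`
  let B : Subalgebra k K := φ.range ⊔ Algebra.adjoin k {y}
  have hBfg : B.FG := by
    refine Subalgebra.FG.sup ?_ ⟨{y}, by rw [Finset.coe_singleton]⟩
    rw [← Algebra.map_top]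
    exact (Algebra.FiniteType.out : (⊤ : Subalgebra k T).FG).map φ
  have hBO : B.toSubring ≤ O.toSubring := by
    intro x hx
    have hx' : x ∈ B := hx
    have hle : B ≤ (⟨O.toSubring.toSubsemiring, fun c => hO c⟩ : Subalgebra k K) := by
      refine sup_le ?_ ?_
      · rintro _ ⟨t, rfl⟩
        exact hφ t
      · exact Algebra.adjoin_le (by simpa using hy)
    exact hle hx'
  obtain ⟨T', instT', instTA', hT's, ψ, χ, hχ, h⟩ :=
    smoothFactor_of_isNoetherianRing k K O hO hN B hBfg hBO
  have hφB : ∀ t : T, φ t ∈ B := fun t => Algebra.mem_sup_left ⟨t, rfl⟩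
  have hyB : y ∈ B := Algebra.mem_sup_right (Algebra.subset_adjoin rfl)
  let φB : T →ₐ[k] B := φ.codRestrict B hφB
  refine ⟨T', instT', instTA', hT's, ψ.comp φB, ψ ⟨y, hyB⟩, χ, hχ, fun t => ?_, ?_, ?_⟩
  · rw [AlgHom.comp_apply, h]; rfl
  · rw [AlgHom.comp_apply, ← map_pow]
    congr 1
    exact Subtype.ext hyg
  · rw [h]

/-- The case `O = K` of the one-root kernel: over a perfect field `k`, for a smooth `k`-algebra
`T`, a `k`-map `φ : T → K` to any field `K ⊇ k`, `g ∈ T` and `y ∈ K` with `y ^ p = φ g`, the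
datum factors through a smooth `k`-algebra (`χ ∘ ψ = φ`, `u ^ p = ψ g`, `χ u = y`). [folklore] -/
theorem pthRootSmoothing_top (p : ℕ) (k K : Type) [Field k] [PerfectField k] [Field K]
    [Algebra k K] (T : Type) [CommRing T] [Algebra k T] (hTs : Algebra.Smooth k T)
    (φ : T →ₐ[k] K) (g : T) (y : K) (hyg : y ^ p = φ g) :
    ∃ (T' : Type) (_ : CommRing T') (_ : Algebra k T'), Algebra.Smooth k T' ∧
      ∃ (ψ : T →ₐ[k] T') (u : T') (χ : T' →ₐ[k] K),
        (∀ t : T, χ (ψ t) = φ t) ∧ u ^ p = ψ g ∧ χ u = y := by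
  obtain ⟨T', _, _, hT', ψ, u, χ, -, h⟩ := pthRootSmoothing_of_isNoetherianRing p k K ⊤
    (fun c => ValuationSubring.mem_top _) inferInstance T hTs φ
    (fun t => ValuationSubring.mem_top _) g y (ValuationSubring.mem_top _) hyg
  exact ⟨T', inferInstance, inferInstance, hT', ψ, u, χ, h⟩

end Summit.ResolutionOfSingularities.ResolutionOfSingularities.Theorems.ValuativeSmoothing
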